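import Mathlib
import Summits.MatrixMultiplication.MatrixMultiplication.Theorems.SnSubsetDichotomyPolynomialSlackMatchingCostHit

/-!
# The cost of over-hitting a family of sets at distinct positions (`ε`-version)

Crux `Summit.MatrixMultiplication.MatrixMultiplication.Theses.SnSubsetDichotomy.PolynomialSlack`
(item `stmt-MatrixMultiplication-8306`), level-one programme, line transport-split-hull (lead c10),
the `ε`-depleted matching branch of the 3/4 step.  Generalises `matching_cost_hit` (which asks that
half of `B` hits each small set) to an arbitrary excess: if at `m` distinct positions `col c` the set
`B ⊆ S_n` hits `Q c` with total probability at least `∑_c |Q c|/n + m ε` (average EXCESS `ε` per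
cell over the uniform value), then `m ≤ 144 (1+log n) log(4 (n!/|B|)/ε)/ε²`.
Proof (as `matching_cost_hit`): with `Z(b) = #{c : b(col c) ∈ Q c} ≤ m` and `μ = ∑_c |Q c|/n`,
`E_B Z ≥ μ + m ε` gives (Markov on `m - Z`) at least `(ε/2)|B|` elements with `Z ≥ μ + m ε/2`; the
permuted sum of the `0/1` array `b(x, y) = [∃ c, col c = x ∧ y ∈ Q c]` (`∑ b² = n μ ≤ n m`, range `1`)
and `card_permutedSum_tail_le` with `t = m ε/2` give `(ε/2)|B| ≤ 2 n! exp(-m ε²/(128(1+log n) + 16 ε))`.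
-/

set_option linter.dupNamespace false

open scoped BigOperators

namespace Summit.MatrixMultiplication.MatrixMultiplication.Theorems.PolynomialSlack

/-- **Cost of over-hitting sets at distinct positions.**  `B ⊆ S_n` non-empty, `col` injective,
`∑_c |Q c|/n + m ε ≤ ∑_c P_B(b (col c) ∈ Q c)` (`0 < ε ≤ 1`)
`⇒ m ≤ 144 (1 + log n) log (4 (n!/|B|)/ε) / ε²`. [folklore] -/
theorem matching_cost_hit_eps {n m : ℕ} (hn : 1 ≤ n) (B : Finset (Equiv.Perm (Fin n)))
    (hB : B.Nonempty) (col : Fin m → Fin n) (hcol : Function.Injective col)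
    (Q : Fin m → Finset (Fin n)) (ε : ℝ) (hε : 0 < ε) (hε1 : ε ≤ 1)
    (hhit : ∑ c, ((Q c).card : ℝ) / n + m * ε ≤
      ∑ c, ((B.filter fun b => b (col c) ∈ Q c).card : ℝ) / B.card) :
    (m : ℝ) ≤ 144 * (1 + Real.log n) * Real.log (4 * ((n.factorial : ℝ) / B.card) / ε) / ε ^ 2 := by
  -- adapted from `matching_cost_hit` (tree): same array/Bernstein bookkeeping, new Markov step
  -- notation and the basic positivity facts
  set β : ℝ := (B.card : ℝ) with hβ
  have hβ0 : 0 < β := by rw [hβ]; exact_mod_cast hB.card_pos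
  have hnR : (1 : ℝ) ≤ n := by exact_mod_cast hn
  have hn0 : (0 : ℝ) < n := by linarith
  set G : ℝ := 1 + Real.log n with hG
  have hG1 : 1 ≤ G := by rw [hG]; linarith [Real.log_nonneg hnR]
  have hG0 : 0 < G := by linarith
  have hβle : β ≤ n.factorial := by
    rw [hβ]
    have : B.card ≤ Fintype.card (Equiv.Perm (Fin n)) := Finset.card_le_univ _
    rw [Fintype.card_perm, Fintype.card_fin] at this
    exact_mod_cast this
  have hK1 : 1 ≤ (n.factorial : ℝ) / β := by
    rw [le_div_iff₀ hβ0]; linarith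
  have hY : 4 ≤ 4 * ((n.factorial : ℝ) / β) / ε := by
    rw [le_div_iff₀ hε]; nlinarith
  have hY0 : 0 < 4 * ((n.factorial : ℝ) / β) / ε := by linarith
  set L : ℝ := Real.log (4 * ((n.factorial : ℝ) / β) / ε) with hL
  have hL1 : 1 ≤ L := by
    rw [hL, Real.le_log_iff_exp_le hY0]
    exact le_trans Real.exp_one_lt_d9.le (by linarith)
  have hL0 : 0 < L := by linarith
  have hε2 : 0 < ε ^ 2 := by positivity
  -- the uniform mean `μ = Σ_c |Q c| / n`
  set μ : ℝ := ∑ c, ((Q c).card : ℝ) / n with hμ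
  have hμ0 : 0 ≤ μ := by
    rw [hμ]; exact Finset.sum_nonneg fun c _ => by positivity
  -- the case `m = 0`
  rcases Nat.eq_zero_or_pos m with hm | hm
  · have : (m : ℝ) = 0 := by exact_mod_cast hm
    rw [this]
    exact div_nonneg (mul_nonneg (mul_nonneg (by norm_num) hG0.le) hL0.le) hε2.le
  have hmR : (0 : ℝ) < m := by exact_mod_cast hm
  have hmε : (0 : ℝ) < m * ε := mul_pos hmR hε
  -- the `0/1` array `a x y = [∃ c, col c = x ∧ y ∈ Q c]` (at most one `c`, by injectivity)
  set a : Fin n → Fin n → ℝ := fun x y => ∑ c, if col c = x then (if y ∈ Q c then 1 else 0) else 0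
  have ha_apply : ∀ x y, a x y = ∑ c, if col c = x then (if y ∈ Q c then (1 : ℝ) else 0) else 0 :=
    fun x y => rfl
  have ha0 : ∀ x y, 0 ≤ a x y := fun x y =>
    Finset.sum_nonneg fun c _ => by positivity
  have ha1 : ∀ x y, a x y ≤ 1 := by
    intro x y
    have hcnt : ((Finset.univ.filter fun c : Fin m => col c = x).card : ℝ) ≤ 1 := by
      have : (Finset.univ.filter fun c : Fin m => col c = x).card ≤ 1 :=
        Finset.card_le_one.2 fun c₁ h₁ c₂ h₂ =>
          hcol (((Finset.mem_filter.1 h₁).2).trans ((Finset.mem_filter.1 h₂).2).symm)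
      exact_mod_cast this
    calc a x y = ∑ c, (if col c = x then (if y ∈ Q c then (1 : ℝ) else 0) else 0) := rfl
      _ ≤ ∑ c, (if col c = x then (1 : ℝ) else 0) := Finset.sum_le_sum fun c _ => by
          split_ifs
          exacts [le_rfl, zero_le_one, le_rfl]
      _ = ((Finset.univ.filter fun c : Fin m => col c = x).card : ℝ) := Finset.sum_boole _ _
      _ ≤ 1 := hcnt
  -- the hit count `N π = #{c : π (col c) ∈ Q c}` is the permuted-sum statistic of `a`
  set N : Equiv.Perm (Fin n) → ℝ := fun π => ∑ c, if π (col c) ∈ Q c then (1 : ℝ) else 0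
  have hN_apply : ∀ π : Equiv.Perm (Fin n), N π = ∑ c, if π (col c) ∈ Q c then (1 : ℝ) else 0 :=
    fun π => rfl
  have hstat : ∀ π : Equiv.Perm (Fin n), ∑ x, a x (π x) = N π := by
    intro π
    rw [hN_apply]
    simp only [ha_apply]
    rw [Finset.sum_comm]
    refine Finset.sum_congr rfl fun c _ => ?_
    rw [Fintype.sum_ite_eq]
  have hNle : ∀ π : Equiv.Perm (Fin n), N π ≤ m := fun π => by
    calc N π = ∑ c, (if π (col c) ∈ Q c then (1 : ℝ) else 0) := rfl
      _ ≤ ∑ _c : Fin m, (1 : ℝ) := Finset.sum_le_sum fun c _ => by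
          split_ifs
          exacts [le_rfl, zero_le_one]
      _ = m := by simp
  -- total mass `Σ a = Σ_c |Q c| = n μ ≤ m n`, hence `Σ a² ≤ Σ a ≤ m n`
  have hmass : ∑ x, ∑ y, a x y = ∑ c, ((Q c).card : ℝ) := by
    have h1 : ∀ x, ∑ y, a x y = ∑ c, if col c = x then ((Q c).card : ℝ) else 0 := by
      intro x
      simp only [ha_apply]
      rw [Finset.sum_comm]
      refine Finset.sum_congr rfl fun c _ => ?_
      split_ifs
      · rw [Finset.sum_boole, Finset.filter_mem_eq_inter, Finset.univ_inter]
      · simp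
    simp_rw [h1]
    rw [Finset.sum_comm]
    refine Finset.sum_congr rfl fun c _ => ?_
    rw [Fintype.sum_ite_eq]
  have hmean : (∑ x, ∑ y, a x y) / n = μ := by
    rw [hmass, hμ, Finset.sum_div]
  have hSle : ∑ c, ((Q c).card : ℝ) ≤ m * n := by
    calc ∑ c, ((Q c).card : ℝ) ≤ ∑ _c : Fin m, (n : ℝ) := Finset.sum_le_sum fun c _ => by
          exact_mod_cast card_finset_fin_le (Q c)
      _ = m * n := by simp
  have hsq : ∑ x, ∑ y, a x y ^ 2 ≤ m * n := by
    calc ∑ x, ∑ y, a x y ^ 2 ≤ ∑ x, ∑ y, a x y :=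
          Finset.sum_le_sum fun x _ => Finset.sum_le_sum fun y _ =>
            pow_le_of_le_one (ha0 x y) (ha1 x y) two_ne_zero
      _ = ∑ c, ((Q c).card : ℝ) := hmass
      _ ≤ m * n := hSle
  have hS2n : (∑ x, ∑ y, a x y ^ 2) / n ≤ m := by
    rw [div_le_iff₀ hn0]; exact hsq
  -- `Σ_{b ∈ B} N b ≥ (μ + m ε)|B|` (exchange of sums in `hhit`)
  have hsumN : (μ + m * ε) * β ≤ ∑ b ∈ B, N b := by
    have h1 : ∑ b ∈ B, N b = ∑ c, ((B.filter fun b => b (col c) ∈ Q c).card : ℝ) := by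
      simp only [hN_apply]
      rw [Finset.sum_comm]
      refine Finset.sum_congr rfl fun c _ => ?_
      rw [Finset.sum_boole]
    rw [h1, ← le_div_iff₀ hβ0, Finset.sum_div]
    exact hhit
  -- Markov on `m - N ≥ 0`: at least `(ε/2)|B|` elements of `B` have `N ≥ μ + m ε/2`
  have hGd : ε * β / 2 ≤ ((B.filter fun b => μ + m * ε / 2 ≤ N b).card : ℝ) := by
    have h1 : ∑ b ∈ B, N b ≤
        ∑ b ∈ B, ((μ + m * ε / 2) + m * (if μ + m * ε / 2 ≤ N b then (1 : ℝ) else 0)) :=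
      Finset.sum_le_sum fun b _ => by
        split_ifs with h
        · linarith [hNle b]
        · linarith [not_le.1 h]
    have h2 : ∑ b ∈ B, ((μ + m * ε / 2) + m * (if μ + m * ε / 2 ≤ N b then (1 : ℝ) else 0)) =
        (μ + m * ε / 2) * β + m * ((B.filter fun b => μ + m * ε / 2 ≤ N b).card : ℝ) := by
      rw [Finset.sum_add_distrib, Finset.sum_const, nsmul_eq_mul, ← Finset.mul_sum,
        Finset.sum_boole, ← hβ]
      ring
    have h3 : (m : ℝ) * (ε * β / 2) ≤ m * ((B.filter fun b => μ + m * ε / 2 ≤ N b).card : ℝ) := by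
      linarith [hsumN, h1, h2]
    exact le_of_mul_le_mul_left h3 hmR
  set Gd := B.filter fun b => μ + m * ε / 2 ≤ N b with hGd_def
  -- these elements lie in the Bernstein tail at deviation `t = m ε/2` from the uniform mean `μ`
  have hsub : Gd ⊆ Finset.univ.filter fun π : Equiv.Perm (Fin n) =>
      (m : ℝ) * ε / 2 ≤ |∑ x, a x (π x) - (∑ x, ∑ y, a x y) / n| := by
    intro b hb
    rw [Finset.mem_filter] at hb ⊢
    refine ⟨Finset.mem_univ _, ?_⟩
    rw [hstat b, hmean]
    have h2 := hb.2
    exact le_trans (by linarith) (le_abs_self _)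
  have ht : (0 : ℝ) < m * ε / 2 := by positivity
  have hBound := card_permutedSum_tail_le (n := n) 1 a
    (fun x y => abs_le.2 ⟨by linarith [ha0 x y], ha1 x y⟩) ((m : ℝ) * ε / 2) ht
  -- the exponent: `(m ε/2)²/(32(1+log n)Σa²/n + 4 m ε) ≥ m ε²/(144(1 + log n))`
  have hs0 : 0 ≤ ∑ x, ∑ y, a x y ^ 2 :=
    Finset.sum_nonneg fun _ _ => Finset.sum_nonneg fun _ _ => sq_nonneg _
  have hD0 : 0 < 32 * (1 + Real.log n) * (∑ x, ∑ y, a x y ^ 2) / n +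
      8 * 1 * ((m : ℝ) * ε / 2) := by
    have : 0 ≤ 32 * (1 + Real.log n) * (∑ x, ∑ y, a x y ^ 2) / n := by
      rw [← hG]; exact div_nonneg (mul_nonneg (by linarith) hs0) hn0.le
    linarith
  have hDle : 32 * (1 + Real.log n) * (∑ x, ∑ y, a x y ^ 2) / n +
      8 * 1 * ((m : ℝ) * ε / 2) ≤ 36 * m * G := by
    have h1 : 32 * (1 + Real.log n) * (∑ x, ∑ y, a x y ^ 2) / n =
        32 * G * ((∑ x, ∑ y, a x y ^ 2) / n) := by rw [hG]; ring
    rw [h1]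
    have h2 : 32 * G * ((∑ x, ∑ y, a x y ^ 2) / n) ≤ 32 * G * m :=
      mul_le_mul_of_nonneg_left hS2n (by linarith)
    have h3 : (m : ℝ) * ε ≤ m * G := mul_le_mul_of_nonneg_left (hε1.trans hG1) hmR.le
    linarith
  have hexp : (m : ℝ) * ε ^ 2 / (144 * G) ≤ ((m : ℝ) * ε / 2) ^ 2 /
      (32 * (1 + Real.log n) * (∑ x, ∑ y, a x y ^ 2) / n + 8 * 1 * ((m : ℝ) * ε / 2)) := by
    rw [div_le_div_iff₀ (by linarith) hD0]
    calc (m : ℝ) * ε ^ 2 *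
          (32 * (1 + Real.log n) * (∑ x, ∑ y, a x y ^ 2) / n + 8 * 1 * ((m : ℝ) * ε / 2))
        ≤ m * ε ^ 2 * (36 * m * G) := mul_le_mul_of_nonneg_left hDle (by positivity)
      _ = ((m : ℝ) * ε / 2) ^ 2 * (144 * G) := by ring
  have htail : (Gd.card : ℝ) ≤ 2 * n.factorial * Real.exp (-((m : ℝ) * ε ^ 2 / (144 * G))) := by
    calc (Gd.card : ℝ) ≤ ((Finset.univ.filter fun π : Equiv.Perm (Fin n) =>
          (m : ℝ) * ε / 2 ≤ |∑ x, a x (π x) - (∑ x, ∑ y, a x y) / n|).card : ℝ) := by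
          exact_mod_cast Finset.card_le_card hsub
      _ ≤ _ := hBound
      _ ≤ 2 * n.factorial * Real.exp (-((m : ℝ) * ε ^ 2 / (144 * G))) :=
          mul_le_mul_of_nonneg_left (Real.exp_le_exp.2 (neg_le_neg hexp)) (by positivity)
  -- combine: `(ε/2)|B| ≤ 2·n!·exp(-m ε²/(144 G))`, i.e. `exp(m ε²/(144 G)) ≤ 4 (n!/|B|)/ε`
  have hfin : Real.exp ((m : ℝ) * ε ^ 2 / (144 * G)) ≤ 4 * ((n.factorial : ℝ) / β) / ε := by
    have h := hGd.trans htail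
    rw [Real.exp_neg] at h
    have hE := Real.exp_pos ((m : ℝ) * ε ^ 2 / (144 * G))
    have h2 : ε * β / 2 * Real.exp ((m : ℝ) * ε ^ 2 / (144 * G)) ≤
        2 * n.factorial * (Real.exp ((m : ℝ) * ε ^ 2 / (144 * G)))⁻¹ *
          Real.exp ((m : ℝ) * ε ^ 2 / (144 * G)) :=
      mul_le_mul_of_nonneg_right h hE.le
    rw [mul_assoc, inv_mul_cancel₀ hE.ne', mul_one] at h2
    have h4 : 4 * ((n.factorial : ℝ) / β) / ε = 4 * n.factorial / (β * ε) := by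
      field_simp
    rw [h4, le_div_iff₀ (mul_pos hβ0 hε)]
    linarith
  have hlog : (m : ℝ) * ε ^ 2 / (144 * G) ≤ L := by
    rw [hL, Real.le_log_iff_exp_le hY0]; exact hfin
  rw [div_le_iff₀ (by linarith)] at hlog
  rw [le_div_iff₀ hε2]
  linarith [hG0.le, hL0.le]

end Summit.MatrixMultiplication.MatrixMultiplication.Theorems.PolynomialSlack
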